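import Mathlib.Data.List.Chain
import Mathlib.Data.List.Nodup
import Mathlib.Order.Basic
import HarnessLib

/-!
# Venture HSemireg — the copies met by a loop word of a one-sided complex are pairwise distinct

Elementary order bookkeeping behind «LEMMA HONEST (i)» of the computation cell `pub-hsemireg`
(seat w1-aut-1, `widen/W1/HONESTWORD-w1aut1.md` §1; reads: w1-cx-2 CONCUR, ref-w-1). There, a
ONE-SIDED twisted complex has its differential strictly upper-triangular for a total order `≺`
on the copies, so every component `u → v` satisfies `u ≺ v`; a THEOREM-LOOP word through a copy
`x` runs along an OUT-path `x → a₁ → ⋯ → z` and an IN-path `y → b₁ → ⋯ → x`, joined by one free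
leaf. The fact used downstream (the honest letter budgets) is that all copies met are pairwise
distinct: the out-path is a strictly increasing chain starting at `x`, the in-path a strictly
increasing chain ending at `x`, so the former lies strictly above `x`, the latter strictly below,
and no copy is repeated.

Paths are lists related consecutively by `<` of an arbitrary preorder (`List.IsChain`); nothing
else is used.

* `lt_of_mem_out` / `lt_of_mem_in` — every copy on the out-path lies above `x`, every copy on
  the in-path below `x`;
* `nodup_of_isChain_lt` — a strictly increasing chain repeats nothing;
* `nodup_word` — the whole list of copies met, `x :: (out ++ inn)`, is duplicate-free.

HONEST FRAMING. Order bookkeeping on finite lists only; the Lean index of one step of a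
NECESSARY-condition sieve used by the cell. No sheaf, complex, abelian variety or semiregularity
map appears; nothing here says that HC, HC_CM or HC_AV holds, and nothing here is a new case of
anything.
-/

namespace Summit.Ventures.HSemireg

namespace OneSidedWordNodup

variable {α : Type*} [Preorder α]

/-- Every copy on a strictly increasing out-path `x → a₁ → ⋯` lies strictly above `x`. -/
theorem lt_of_mem_out {x : α} {out : List α} (h : List.IsChain (· < ·) (x :: out)) :
    ∀ a ∈ out, x < a :=
  fun _ ha => h.rel_cons ha

/-- Every copy on a strictly increasing in-path `⋯ → b → x` lies strictly below `x`. -/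
theorem lt_of_mem_in {x : α} {inn : List α} (h : List.IsChain (· < ·) (inn ++ [x])) :
    ∀ b ∈ inn, b < x := by
  intro b hb
  have h' : List.IsChain (fun a b => b < a) (x :: inn.reverse) := by
    have := (List.isChain_reverse (R := fun a b => b < a) (l := inn ++ [x])).mpr
      (by simpa using h)
    simpa using this
  exact h'.rel_cons (by simpa using hb)

/-- A strictly increasing chain has no repeated entry. -/
theorem nodup_of_isChain_lt {l : List α} (h : List.IsChain (· < ·) l) : l.Nodup :=
  (List.isChain_iff_pairwise.mp h).nodup

/-- **The copies met by a loop word are pairwise distinct**: for an out-path `x :: out` and an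
in-path `inn ++ [x]`, both strictly increasing, the list `x :: (out ++ inn)` of all copies met
(the base copy once) has no duplicates. -/
theorem nodup_word {x : α} {out inn : List α} (hout : List.IsChain (· < ·) (x :: out))
    (hin : List.IsChain (· < ·) (inn ++ [x])) : (x :: (out ++ inn)).Nodup := by
  have hout' : out.Nodup := (nodup_of_isChain_lt hout).of_cons
  have hin' : inn.Nodup := (nodup_of_isChain_lt hin).of_append_left
  have hxo : x ∉ out := fun hx => lt_irrefl x (lt_of_mem_out hout x hx)
  have hxi : x ∉ inn := fun hx => lt_irrefl x (lt_of_mem_in hin x hx)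
  have hdis : out.Disjoint inn := by
    intro a hao hai
    exact lt_irrefl x (lt_trans (lt_of_mem_out hout a hao) (lt_of_mem_in hin a hai))
  refine List.nodup_cons.mpr ⟨?_, List.nodup_append.mpr ⟨hout', hin', ?_⟩⟩
  · simpa [List.mem_append] using And.intro hxo hxi
  · intro a ha b hb hab
    exact hdis ha (hab ▸ hb)

end OneSidedWordNodup

end Summit.Ventures.HSemireg
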